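import Mathlib
import Summits.Ventures.PercRepro2.LocRows2
import Summits.Ventures.PercRepro2.LocSym
import Summits.Ventures.PercRepro2.LocPairing

/-!
# The per-hull (h-free, outside-free) form of the pairing (blind cell PercRepro2, night-4;
census 2026-08-24T01:5xZ, own code `work/perhull.py`, `involU_samehull.py`)

The pairing (PAIR-𝓤) of `LocPairing` can be asked HULL BY HULL. Fix the graph, the root `l`, the
mark `o` and a vertex set `H ∋ l, o`. The INSIDE CLASS `insideCls H` consists of the colourings of
the edges touching `H` (the other edges normalised to `false`) whose hull `C_R(l) ∪ C_B(l)` is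
exactly `H` and which have `o` on the blue side. **(PAIR-hull)** (`PairHull`) asks for an involution
`τ_H` of `insideCls H` such that two partners agree only on edges touching both blue clusters.

Nothing else enters: the vertex `h` only selects the hulls (`h ∉ H`), and the edges outside `H` are
complemented. Theorem `pairU_of_pairHull`: (PAIR-hull) for every `H` gives (PAIR-𝓤) at the principal
up-set `{S ∣ o ∈ S}` for EVERY `h` — the global involution is
`τ ζ = (τ_H (ζ|_{E_H})) on E_H, complement of ζ off E_H` with `H = H_l(ζ)`; hence (LOC-sym),
(LOC-𝓤), 2′DOM2 and (BASE) on every fibre.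

Census (exact, night-4): a (PAIR-hull) involution exists for EVERY `(G, l, o, H)` with
`insideCls H ≠ ∅` at `n = 4, 5, 6` (118 / 1,026 / 12,578 hull classes, 0 failures); the same-hull
restriction of (PAIR-𝓤) holds for ALL up-sets at `n ≤ 5` (84 / 2,768 cases) and on the first 40
six-vertex graphs (108,031 cases). The whole content of the (DOM) family now sits INSIDE one hull.
-/

namespace Summit.Ventures.PercRepro2

namespace LocRows

open Hull

variable {V : Type*} {E : Type*} [Fintype E] [DecidableEq E]

open scoped Classical

variable (ends : E → Sym2 V)

/-- Membership in the principal source set, unfolded. -/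
lemma mem_srcU_principal {l h o : V} {ζ : Config E} :
    ζ ∈ srcU ends l h {S : Set V | o ∈ S} ↔
      h ∉ hull ends ζ l ∧ o ∈ cluster ends (blue ζ) l ∧ o ∉ cluster ends ζ l := by
  simp only [srcU, Finset.mem_filter, Finset.mem_univ, true_and, Set.mem_setOf_eq]

/-! ## Clusters of `l` depend only on the edges touching the hull -/

omit [Fintype E] [DecidableEq E] in
/-- `touches` is monotone. -/
lemma touches_mono' {S T : Set V} (hST : S ⊆ T) : touches ends S ⊆ touches ends T :=
  fun _ ⟨x, hx, y, h⟩ => ⟨x, hST hx, y, h⟩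

omit [Fintype E] [DecidableEq E] in
/-- Two colourings agreeing on every edge touching the hull of `l` have the same red and blue
clusters of `l` (domain Markov property). -/
lemma clusters_eq_of_eqOn_hull {ζ ζ' : Config E} {l : V}
    (hagree : ∀ e ∈ touches ends (hull ends ζ l), ζ e = ζ' e) :
    cluster ends ζ' l = cluster ends ζ l ∧ cluster ends (blue ζ') l = cluster ends (blue ζ) l := by
  constructor
  · exact cluster_eq_of_eqOn_touches
      (fun e he => hagree e (touches_mono' ends (fun _ hx => Or.inl hx) he)) rfl
  · refine cluster_eq_of_eqOn_touches (ω := blue ζ) (ω' := blue ζ') ?_ rfl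
    intro e he
    rw [blue_apply, blue_apply, hagree e (touches_mono' ends (fun _ hx => Or.inr hx) he)]

omit [Fintype E] [DecidableEq E] in
/-- Consequently the hull is the same. -/
lemma hull_eq_of_eqOn_hull {ζ ζ' : Config E} {l : V}
    (hagree : ∀ e ∈ touches ends (hull ends ζ l), ζ e = ζ' e) :
    hull ends ζ' l = hull ends ζ l := by
  obtain ⟨h1, h2⟩ := clusters_eq_of_eqOn_hull ends hagree
  unfold hull
  rw [h1, h2]

/-! ## The inside class and the restriction / gluing maps -/

/-- The restriction of `ζ` to the edges touching `H`, the other edges normalised to `false`. -/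
noncomputable def zeroOff (H : Set V) (ζ : Config E) : Config E :=
  fun e => if e ∈ touches ends H then ζ e else false

/-- Gluing: `η` on the edges touching `H`, the complement of `ζ` elsewhere. -/
noncomputable def glue (H : Set V) (η ζ : Config E) : Config E :=
  fun e => if e ∈ touches ends H then η e else !ζ e

/-- The inside class of the hull `H`: colourings supported on the edges touching `H`, with hull
exactly `H` and `o` on the blue side. -/
noncomputable def insideCls (l o : V) (H : Set V) : Finset (Config E) :=
  Finset.univ.filter fun η =>
    hull ends η l = H ∧ o ∈ bside ends η l ∧ ∀ e, e ∉ touches ends H → η e = false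

/-- **(PAIR-hull)**: an involution of the inside class of `H` whose partners agree (on the edges
touching `H`) only on edges touching both blue clusters of `l`. -/
def PairHull (l o : V) (H : Set V) : Prop :=
  ∃ τ : Config E → Config E,
    (∀ η ∈ insideCls ends l o H, τ η ∈ insideCls ends l o H) ∧
    (∀ η ∈ insideCls ends l o H, τ (τ η) = η) ∧
    (∀ η ∈ insideCls ends l o H, ∀ e ∈ touches ends H, η e = τ η e →
      e ∈ touches ends (cluster ends (blue η) l) ∧ e ∈ touches ends (cluster ends (blue (τ η)) l))

/-- Membership in the inside class, unfolded. -/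
lemma mem_insideCls {l o : V} {H : Set V} {η : Config E} :
    η ∈ insideCls ends l o H ↔
      hull ends η l = H ∧ o ∈ bside ends η l ∧ ∀ e, e ∉ touches ends H → η e = false := by
  simp only [insideCls, Finset.mem_filter, Finset.mem_univ, true_and]

omit [Fintype E] [DecidableEq E] in
/-- `zeroOff` agrees with `ζ` on the edges touching `H`. -/
lemma zeroOff_apply_of_mem {H : Set V} {ζ : Config E} {e : E} (he : e ∈ touches ends H) :
    zeroOff ends H ζ e = ζ e := by
  simp [zeroOff, he]

omit [Fintype E] [DecidableEq E] in
/-- `glue` agrees with `η` on the edges touching `H`. -/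
lemma glue_apply_of_mem {H : Set V} {η ζ : Config E} {e : E} (he : e ∈ touches ends H) :
    glue ends H η ζ e = η e := by
  simp [glue, he]

omit [Fintype E] [DecidableEq E] in
/-- `glue` is the complement of `ζ` off the edges touching `H`. -/
lemma glue_apply_of_notMem {H : Set V} {η ζ : Config E} {e : E} (he : e ∉ touches ends H) :
    glue ends H η ζ e = !ζ e := by
  simp [glue, he]

omit [Fintype E] [DecidableEq E] in
/-- The restriction to the hull keeps the clusters of `l`. -/
lemma clusters_zeroOff {ζ : Config E} {l : V} :
    cluster ends (zeroOff ends (hull ends ζ l) ζ) l = cluster ends ζ l ∧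
      cluster ends (blue (zeroOff ends (hull ends ζ l) ζ)) l = cluster ends (blue ζ) l :=
  clusters_eq_of_eqOn_hull ends (fun _ he => (zeroOff_apply_of_mem ends he).symm)

omit [Fintype E] [DecidableEq E] in
/-- Gluing an inside colouring of hull `H` onto any outside keeps its clusters of `l`. -/
lemma clusters_glue {η ζ : Config E} {l : V} {H : Set V} (hη : hull ends η l = H) :
    cluster ends (glue ends H η ζ) l = cluster ends η l ∧
      cluster ends (blue (glue ends H η ζ)) l = cluster ends (blue η) l :=
  clusters_eq_of_eqOn_hull ends (fun e he => by
    rw [hη] at he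
    exact (glue_apply_of_mem ends he).symm)

/-- The restriction of a source configuration to its hull lies in the inside class of that hull. -/
lemma zeroOff_mem_insideCls {l h o : V} {ζ : Config E}
    (hζ : ζ ∈ srcU ends l h {S : Set V | o ∈ S}) :
    zeroOff ends (hull ends ζ l) ζ ∈ insideCls ends l o (hull ends ζ l) := by
  rw [mem_srcU_principal] at hζ
  obtain ⟨h1, h2⟩ := clusters_zeroOff ends (ζ := ζ) (l := l)
  rw [mem_insideCls]
  refine ⟨?_, ⟨?_, ?_⟩, fun _ he => by simp [zeroOff, he]⟩
  · exact hull_eq_of_eqOn_hull ends (fun _ he => (zeroOff_apply_of_mem ends he).symm)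
  · rw [h2]; exact hζ.2.1
  · rw [h1]; exact hζ.2.2

/-- Gluing an inside colouring of the hull of a source configuration onto its complemented outside
gives a source configuration with the same hull. -/
lemma glue_mem_src {l h o : V} {ζ η : Config E}
    (hζ : ζ ∈ srcU ends l h {S : Set V | o ∈ S})
    (hη : η ∈ insideCls ends l o (hull ends ζ l)) :
    glue ends (hull ends ζ l) η ζ ∈ srcU ends l h {S : Set V | o ∈ S} := by
  rw [mem_srcU_principal] at hζ ⊢
  rw [mem_insideCls] at hη
  obtain ⟨h1, h2⟩ := clusters_glue ends (ζ := ζ) (l := l) hη.1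
  have hH : hull ends (glue ends (hull ends ζ l) η ζ) l = hull ends ζ l := by
    have := hull_eq_of_eqOn_hull ends (ζ := η) (ζ' := glue ends (hull ends ζ l) η ζ) (l := l)
      (fun e he => by rw [hη.1] at he; exact (glue_apply_of_mem ends he).symm)
    rw [this]; exact hη.1
  refine ⟨by rw [hH]; exact hζ.1, ?_, ?_⟩
  · rw [h2]; exact hη.2.1.1
  · rw [h1]; exact hη.2.1.2

/-! ## The global involution from the per-hull ones -/

/-- The global pairing built from the per-hull pairings `τs`. -/
noncomputable def glueTau (τs : Set V → Config E → Config E) (l : V) (ζ : Config E) : Config E :=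
  glue ends (hull ends ζ l) (τs (hull ends ζ l) (zeroOff ends (hull ends ζ l) ζ)) ζ

/-- **(PAIR-hull) for every hull gives (PAIR-𝓤) at the principal up-set, for every `h`.** -/
theorem pairU_of_pairHull (l o : V) (hH : ∀ H : Set V, PairHull ends l o H) (h : V) :
    PairU ends l h {S : Set V | o ∈ S} := by
  choose τs hmem hinv hrel using hH
  -- membership of the glued configuration in the source set
  have hmemSrc : ∀ ζ ∈ srcU ends l h {S : Set V | o ∈ S},
      glueTau ends τs l ζ ∈ srcU ends l h {S : Set V | o ∈ S} := fun ζ hζ =>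
    glue_mem_src ends hζ (hmem _ _ (zeroOff_mem_insideCls ends hζ))
  -- the hull is preserved
  have hhull : ∀ ζ ∈ srcU ends l h {S : Set V | o ∈ S},
      hull ends (glueTau ends τs l ζ) l = hull ends ζ l := fun ζ hζ => by
    have hη := (mem_insideCls ends).1 (hmem _ _ (zeroOff_mem_insideCls ends hζ))
    have := hull_eq_of_eqOn_hull ends (ζ := τs (hull ends ζ l) (zeroOff ends (hull ends ζ l) ζ))
      (ζ' := glueTau ends τs l ζ) (l := l)
      (fun e he => by rw [hη.1] at he; exact (glue_apply_of_mem ends he).symm)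
    rw [this]; exact hη.1
  -- the restriction of the glued configuration is the paired inside colouring
  have hzero : ∀ ζ ∈ srcU ends l h {S : Set V | o ∈ S},
      zeroOff ends (hull ends ζ l) (glueTau ends τs l ζ) =
        τs (hull ends ζ l) (zeroOff ends (hull ends ζ l) ζ) := fun ζ hζ => by
    have hη := (mem_insideCls ends).1 (hmem _ _ (zeroOff_mem_insideCls ends hζ))
    funext e
    by_cases he : e ∈ touches ends (hull ends ζ l)
    · rw [zeroOff_apply_of_mem ends he]
      exact glue_apply_of_mem ends he
    · simp only [zeroOff, he, if_false]
      exact (hη.2.2 e he).symm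
  refine ⟨fun x => ⟨glueTau ends τs l x.1, hmemSrc x.1 x.2⟩, ?_, ?_⟩
  · -- involution
    intro x
    apply Subtype.ext
    show glueTau ends τs l (glueTau ends τs l x.1) = x.1
    have hH' := hhull x.1 x.2
    have hz := hzero x.1 x.2
    have hunf : glueTau ends τs l (glueTau ends τs l x.1) =
        glue ends (hull ends (glueTau ends τs l x.1) l)
          (τs (hull ends (glueTau ends τs l x.1) l)
            (zeroOff ends (hull ends (glueTau ends τs l x.1) l) (glueTau ends τs l x.1)))
          (glueTau ends τs l x.1) := rfl
    rw [hunf, hH', hz, hinv _ _ (zeroOff_mem_insideCls ends x.2)]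
    funext e
    by_cases he : e ∈ touches ends (hull ends x.1 l)
    · rw [glue_apply_of_mem ends he, zeroOff_apply_of_mem ends he]
    · rw [glue_apply_of_notMem ends he]
      have hg : glueTau ends τs l x.1 e = !x.1 e := glue_apply_of_notMem ends he
      rw [hg, Bool.not_not]
  · -- the pairing relation
    intro x e he
    have hη := zeroOff_mem_insideCls ends x.2
    have hηt := hmem _ _ hη
    by_cases heH : e ∈ touches ends (hull ends x.1 l)
    · -- an agreement edge touching the hull: use the per-hull relation
      have hagree : zeroOff ends (hull ends x.1 l) x.1 e =
          τs (hull ends x.1 l) (zeroOff ends (hull ends x.1 l) x.1) e := by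
        rw [zeroOff_apply_of_mem ends heH]
        have := he
        simp only at this
        rw [this]
        exact glue_apply_of_mem ends heH
      obtain ⟨hb1, hb2⟩ := hrel _ _ hη e heH hagree
      obtain ⟨-, hz2⟩ := clusters_zeroOff ends (ζ := x.1) (l := l)
      have hηt' := (mem_insideCls ends).1 hηt
      obtain ⟨-, hg2⟩ := clusters_glue ends (ζ := x.1) (l := l) hηt'.1
      refine ⟨?_, ?_⟩
      · rw [hz2] at hb1; exact hb1
      · show e ∈ touches ends (cluster ends (blue (glueTau ends τs l x.1)) l)
        have hg2' : cluster ends (blue (glueTau ends τs l x.1)) l =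
            cluster ends (blue (τs (hull ends x.1 l) (zeroOff ends (hull ends x.1 l) x.1))) l := hg2
        rw [hg2']; exact hb2
    · -- off the hull the glued configuration is the complement: no agreement there
      exfalso
      have := he
      simp only at this
      have hg : glueTau ends τs l x.1 e = !x.1 e := glue_apply_of_notMem ends heH
      rw [hg] at this
      cases x.1 e <;> simp at this

/-- (PAIR-hull) for every hull gives (LOC-sym) at the principal up-set, for every `h`. -/
theorem locSym_of_pairHull (l o : V) (hH : ∀ H : Set V, PairHull ends l o H) (h : V) :
    LocSym ends l h {S : Set V | o ∈ S} :=
  locSym_of_pairU ends l h _ (pairU_of_pairHull ends l o hH h)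

/-- (PAIR-hull) over all finite graphs, roots, marks and vertex sets. -/
def PairHull_all : Prop :=
  ∀ (V E : Type) [Fintype V] [DecidableEq V] [Fintype E] [DecidableEq E] (ends : E → Sym2 V)
    (l o : V) (H : Set V), l ≠ o → l ∈ H → o ∈ H → PairHull ends l o H

end LocRows

end Summit.Ventures.PercRepro2
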